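import Literature.MathematicalPhysics.QuantumFieldTheory.Balaban1983to89.B4Thm110BoxDerivCut
import Literature.MathematicalPhysics.QuantumFieldTheory.Balaban1983to89.B4Thm19BoxHolderWalk

/-!
# `Balaban1983to89.B4Thm19BoxHolderCut` — [Balaban1983RegularityDecay] THEOREM p. 573, (1.9) THE HÖLDER MEMBER, ON A
# BOX `Ω` WITH THE PRINT's CUT CUBES `□_j` (p. 575) — r01's route `B4Ineq19WalkRoute.ineq19_holder_apply` with
# `S_j := □_j`, `G_j := pad(G_k(□_j,Ã_j)) + cinv`; the per-cube Hölder letter obtained BY PADDING from p17 g4's η-uniform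
# `B4HolderLetterBox.holder_letter_box` ON THE SUB-BOX (sides `≤ 2K`, so uniform in `Ω` as well)

statement-level skeleton of published theorems with citation tags; proofs where landed; nothing here is a claim about the Yang–Mills mass gap

CITATION HEADER.  T. Bałaban, *Regularity and decay of lattice Green's functions*, Commun. Math. Phys. **89** (1983)
571–597, doi:10.1007/bf01214744 [Balaban1983RegularityDecay] (cell paper B4; held text
`paper:balaban1983-cmp89-regularity-decay`, journal page = PDF page + 570; pp. 572–573, 575–579).  Unit `lit-balaban-p17`
gen 5 (Phase-2 proof seat p17; HOME `run/shared/lean/pub/lit-balaban/`), SKELETON rows **B4.Thm@573** ((1.9), rectangular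
`Ω`), **B4.Eq2.2**, **B4.Eq2.18** ((2.18) first letter in `‖·‖_{1,α}`).  Imports p17 g5 `B4Thm110BoxDerivCut` (pad algebra,
cut data) and p17 g4 `B4Thm19BoxHolderWalk` (→ `B4HolderLetterBox.holder_letter_box`, `lsum_congr_of_forall`,
`abs_posR_sub_le`; r01 g6 `B4Ineq19WalkRoute.ineq19_holder_apply`, `holderOp_mul_mulH`).

WHAT IS PRINTED.  p. 573 (1.9): «|x − x′|^{−α}|U(A(Γ_{x,x′}))(D^η_{A,μ}G_k(Ω,A)f)(x′) − (D^η_{A,μ}G_k(Ω,A)f)(x)| ≤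
c₀exp(−δ₀dist({x,x′}, supp f))‖f‖_∞ … For some simple sets Ω, e.g. for rectangular parallelepipeds, the inequalities hold
without any restrictions on the points x, x′»; p. 578 (2.18) (the first letter carries `‖·‖_{1,α}` of (2.14)); p. 578 «If
|x′ − x| > 1, then this inequality is a simple consequence of the corresponding inequality for the derivative only».

WHAT THIS MODULE PROVES (all in full; `Ω = Box d ℓ k Mb`, `n = (ℓ+1)^k`, `d ≥ 1`, `K ∣ Mb_μ`, `16 ≤ K`, `4 ∣ K`).
* §1 chains under the sub-box translation: `nbrs_subEmb_iff`, `pathEnd_map`, `transport_map`, `exists_chain_preimage_sub`.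
* §2 **`thm19_holder_boxCut`** — THEOREM (1.9) on `Ω` with the cut cubes: arbitrary `A`, antisymmetric cube configurations
  `Ã_j` agreeing with `A` on the plateaus, per-cube inputs ON THE SUB-BOXES: `c_G`, `c_D` (Lemma 2.2 (2.17) `n = 0, 1`),
  `c_H` (Lemma 2.2 (2.16) for EVERY close pair and chain of the sub-box, the form of p35's
  `B4Lemma22HolderCubeField.lemma22_holder_cubeField`), `c_K` ((2.20)), `3^{d+1}√N c_K ≤ e^{−1}`; then for `x ≠ x′`,
  `32|x′−x|_∞ ≤ nK`, `x+e_μ, x′+e_μ ∈ Ω`, a nearest-neighbour chain `Γ` from `x` to `x′` of length `≤ (d+1)|x′−x|_∞` inside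
  the `|x′−x|_∞`-ball, `0 ≤ α ≤ 1`, `f` supported at unit-lattice sup-distance `≥ D` from `x`:
  `(n/r)^α·|U(A(Γ))(D^η_{A,μ}G_k(Ω,A)f)(x′) − (D^η_{A,μ}G_k(Ω,A)f)(x)| ≤ 2^{d+4}e^{5/2}γ_H e^{−D/K}‖f‖_∞`,
  `γ_H = √N(c_H + (d+1)D₁c_D + (d+3)s c_D + (d+1)(D₁²+D₂)c_G)` — every `x` (no `R₀`), uniform in `η`; the per-cube letter:
  the four points and `Γ` lie in the plateau of every cube that sees them, hence in the sub-box; probe, transport and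
  letter are paddings (`unitOp_eq_pad`, `transport_map`, `cube_letter_a`), `pad` is multiplicative and isometric, and
  `holder_letter_box` applies on the sub-box.  **`thm19_holder_boxCut_cubeField`**: `A = compField Ac`,
  `Ã_j = cubeField Ω n K j (A₀ j) Ac`.
HONEST SCOPE.  Hölder member for close pairs (far pairs: the derivative member, p. 578); `d ≥ 1`; inputs are hypotheses
(discharged uniformly in `Ω` in `B4Thm19BoxHolderUniform`).  No `def`, no `Prop` fact, no `sorry`; axioms standard.
-/

namespace Literature.MathematicalPhysics.QuantumFieldTheory.Balaban1983to89.B4Thm19BoxHolderCut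

open Literature.MathematicalPhysics.QuantumFieldTheory.Balaban1983to89.B4Reflection242 (boxDom mem_boxDom nbrs mem_nbrs)
open Literature.MathematicalPhysics.QuantumFieldTheory.Balaban1983to89.B4GaugeCovariance
open Literature.MathematicalPhysics.QuantumFieldTheory.Balaban1983to89.B4Commutators25to211 (mulH opK)
open Literature.MathematicalPhysics.QuantumFieldTheory.Balaban1983to89.B4Lower18Regular (e1 e1_apply_self e1_apply_ne
  lsum baseEmb stairContour transport_fieldLink)
open Literature.MathematicalPhysics.QuantumFieldTheory.Balaban1983to89.B4Lemma21Region (siteNorm covDeriv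
  fld_covDeriv_mulVec_of_mem)
open Literature.MathematicalPhysics.QuantumFieldTheory.Balaban1983to89.B4Lemma22ReduceZero (Box opA greenA derivA)
open Literature.MathematicalPhysics.QuantumFieldTheory.Balaban1983to89.B4Lemma22Reduce231 (supN supN_nonneg)
open Literature.MathematicalPhysics.QuantumFieldTheory.Balaban1983to89.B4Lemma22Invertible (opA_stair_isUnit_det)
open Literature.MathematicalPhysics.QuantumFieldTheory.Balaban1983to89.B4PartitionUnity22 (hCube hCube_ne_zero_imp hprof
  D1 D2 D1_nonneg D2_nonneg contDiff_hprof hasCompactSupport_hprof)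
open Literature.MathematicalPhysics.QuantumFieldTheory.Balaban1983to89.B4ContourShift (supNorm abs_le_supNorm
  supNorm_nonneg)
open Literature.MathematicalPhysics.QuantumFieldTheory.Balaban1983to89.B4Eq220PartitionSizes (hBox)
open Literature.MathematicalPhysics.QuantumFieldTheory.Balaban1983to89.B4Eq220CommutatorField (kOp)
open Literature.MathematicalPhysics.QuantumFieldTheory.Balaban1983to89.B4Lemma22HolderBox (IsNNChain)
open Literature.MathematicalPhysics.QuantumFieldTheory.Balaban1983to89.B4Ineq19WalkRoute (ineq19_holder_apply
  holderOp_mul_mulH)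
open Literature.MathematicalPhysics.QuantumFieldTheory.Balaban1983to89.B4CubeOpReindex (pad pad_sub pad_mul norm_pad
  linfty_opNorm_le_of_supN)
open Literature.MathematicalPhysics.QuantumFieldTheory.Balaban1983to89.B4SubBoxCarrier (subEmb inSub inSub_iff
  subEmb_injective mem_nbrs_add_iff lsum_map)
open Literature.MathematicalPhysics.QuantumFieldTheory.Balaban1983to89.B4CubeGreenBox (subField cubeW cubeT cubeGreen
  cubeOp_mul_cubeGreen cube_letter_a cube_letter_b)
open Literature.MathematicalPhysics.QuantumFieldTheory.Balaban1983to89.B4BoxCubeGeometry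
open Literature.MathematicalPhysics.QuantumFieldTheory.Balaban1983to89.B4HolderChainTools (one_le_supNorm_of_ne)
open Literature.MathematicalPhysics.QuantumFieldTheory.Balaban1983to89.B4HolderLetterBox (holder_letter_box)
open Literature.MathematicalPhysics.QuantumFieldTheory.Balaban1983to89.B4Lower18RegularRegion (compField)
open Literature.MathematicalPhysics.QuantumFieldTheory.Balaban1983to89.B4CubeFields22 (cubeField cubeField_antisymm
  cubeField_eq_compField)
open Literature.MathematicalPhysics.QuantumFieldTheory.Balaban1983to89.B4Thm110BoxWalk (plateau_fine hCube_posR_eq_hBox)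
open Literature.MathematicalPhysics.QuantumFieldTheory.Balaban1983to89.B4Thm19BoxHolderWalk (lsum_congr_of_forall
  abs_posR_sub_le)
open Literature.MathematicalPhysics.QuantumFieldTheory.Balaban1983to89.B4Thm110BoxCut
open Literature.MathematicalPhysics.QuantumFieldTheory.Balaban1983to89.B4Thm110BoxDerivCut (pad_smul unitOp_eq_pad)
open scoped Matrix
open scoped Matrix.Norms.Operator

noncomputable section

variable {d : ℕ}
variable {ι : Type} [Fintype ι] [DecidableEq ι]

/-! ## §1. Nearest-neighbour chains under the sub-box translation -/

section Chains

omit [Fintype ι] [DecidableEq ι] in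
/-- the end point of an embedded contour (the contour `Γ_{x,x′}` read on the translated cube).
[cite: Balaban1983RegularityDecay, p.573 «Γ_{x,x′} a shortest contour connecting these points», dictionary] -/
theorem pathEnd_map {X X' : Type*} (e : X' → X) (a : X') (l : List X') : pathEnd (e a) (l.map e) = e (pathEnd a l) := by
  induction l generalizing a with
  | nil => rfl
  | cons b l ih => simp only [List.map_cons, pathEnd, ih]

/-- **parallel transport along an embedded contour is the transport of the pulled-back links**:
`U_W(e(a); e(l)) = U_{W∘(e×e)}(a; l)`. [cite: Balaban1983RegularityDecay, (1.4) p.572, dictionary] -/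
theorem transport_map {X X' : Type*} (W : X → X → Matrix ι ι ℝ) (e : X' → X) (a : X') (l : List X') :
    transport W (e a) (l.map e) = transport (fun u v => W (e u) (e v)) a l := by
  induction l generalizing a with
  | nil => rfl
  | cons b l ih => simp only [List.map_cons, transport, ih]

variable (ℓ k : ℕ) (Mb Ms : Fin (d + 1) → ℕ) (o : Fin (d + 1) → ℕ)

omit [Fintype ι] [DecidableEq ι] in
/-- nearest neighbours are read through the translation `subEmb`. [cite: Balaban1983RegularityDecay, (1.3) p.572, dictionary] -/
theorem nbrs_subEmb_iff (ho : ∀ i, o i + Ms i ≤ Mb i) (a b : ↥(Box d ℓ k Ms)) :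
    (subEmb ℓ k Mb Ms o ho b).1 ∈ nbrs (subEmb ℓ k Mb Ms o ho a).1 ↔ b.1 ∈ nbrs a.1 :=
  mem_nbrs_add_iff a.1 b.1 _

omit [Fintype ι] [DecidableEq ι] in
/-- **a nearest-neighbour chain of `Ω` inside the sub-box is an embedded chain of the sub-box** (the contour `Γ_{x,x′}` read
on `□_j`), with the same length and the corresponding end point. [cite: Balaban1983RegularityDecay, p.573 «a shortest
contour», §2 p.575, dictionary] -/
theorem exists_chain_preimage_sub (ho : ∀ i, o i + Ms i ≤ Mb i) :
    ∀ (x : ↥(Box d ℓ k Mb)) (l : List ↥(Box d ℓ k Mb)) (a0 : ↥(Box d ℓ k Ms)),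
      subEmb ℓ k Mb Ms o ho a0 = x → IsNNChain x l → (∀ z ∈ l, inSub ℓ k Mb Ms o z) →
      ∃ lB : List ↥(Box d ℓ k Ms), lB.map (subEmb ℓ k Mb Ms o ho) = l ∧ IsNNChain a0 lB ∧
        subEmb ℓ k Mb Ms o ho (pathEnd a0 lB) = pathEnd x l ∧ lB.length = l.length := by
  intro x l
  induction l generalizing x with
  | nil => exact fun a0 hx _ _ => ⟨[], rfl, trivial, hx, rfl⟩
  | cons z l ih =>
      intro a0 hx hl hmem
      obtain ⟨c, hc⟩ := (inSub_iff ℓ k Mb Ms o ho z).1 (hmem z List.mem_cons_self)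
      obtain ⟨hz, hl'⟩ := hl
      obtain ⟨lB, h1, h2, h3, h4⟩ := ih z c hc hl' fun z' hz' => hmem z' (List.mem_cons_of_mem z hz')
      refine ⟨c :: lB, by rw [List.map_cons, hc, h1], ⟨?_, h2⟩, h3, by rw [List.length_cons, List.length_cons, h4]⟩
      rw [← nbrs_subEmb_iff ℓ k Mb Ms o ho a0 c, hc, hx]
      exact hz

end Chains

/-! ## §2. THEOREM (1.9), the Hölder member, on a box — the route with the CUT cubes -/

section Route

omit [Fintype ι] [DecidableEq ι] in
/-- coordinates of `x + e_μ − x` are `≤ 1` in absolute value. [folklore] -/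
private theorem abs_e1_cast_le (μ ν : Fin (d + 1)) : |((e1 μ ν : ℤ) : ℝ)| ≤ 1 := by
  by_cases h : ν = μ
  · subst h; rw [e1_apply_self]; simp
  · rw [e1_apply_ne h]; simp

/-- **THEOREM (1.9) ON A BOX `Ω`, THE HÖLDER MEMBER, WITH THE PRINT's CUT CUBES, UNIFORMLY IN `η`.**  Data as in
`B4Thm110BoxDerivCut.thm110_deriv_boxCut` (box, `d ≥ 1`, `16 ≤ K`, `4 ∣ K`, `K ∣ Mb_μ`, arbitrary `A`, antisymmetric cube
configurations `Ã_j` agreeing with `A` on the plateaus) and, for every `j ∈ labelsK Mb K`, ON THE SUB-BOX `□_j` (field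
`Ã_j|□_j = subField … (Ã_j)`, `G = G_k(□_j, Ã_j|□_j)`): `‖GΦ‖_∞ ≤ c_G‖Φ‖_∞`, `‖D^η_νGΦ‖_∞ ≤ c_D‖Φ‖_∞` (all `ν`), the Hölder
bound `(n/r)^α|U(Ã(Γ))(D^η_μGΦ)(a′) − (D^η_μGΦ)(a)| ≤ c_H‖Φ‖_∞` for EVERY pair `a ≠ a′` of the sub-box with forward bonds and
every nearest-neighbour chain of length `≤ (d+1)|a′−a|_∞`, `‖K_hGhΦ‖_∞ ≤ c_K‖Φ‖_∞` (`h = hBox n K (cubeMs j) (jloc j)`),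
`3^{d+1}√N c_K ≤ e^{−1}`.  Then for `x ≠ x′`, `32|x′−x|_∞ ≤ nK`, `x+e_μ, x′+e_μ ∈ Ω`, a nearest-neighbour chain `Γ` from `x`
to `x′` of length `≤ (d+1)|x′−x|_∞` inside the ball of radius `|x′−x|_∞` about `x`, `0 ≤ α ≤ 1`, and `f` supported in `P` at
unit-lattice sup-distance `≥ D` from `x` with `|f| ≤ φ`:
`(n/r)^α·|U(A(Γ))(D^η_{A,μ}G_k(Ω,A)f)(x′) − (D^η_{A,μ}G_k(Ω,A)f)(x)| ≤ 2^{d+4}e^{5/2}γ_H e^{−D/K}φ`,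
`γ_H = √N(c_H + (d+1)D1c_D + (d+3)s c_D + (d+1)(D1²+D2)c_G)`.
[cite: Balaban1983RegularityDecay, Theorem (1.9) p.573; (2.14), (2.18) pp.577–578, (2.2)–(2.4), (2.6) pp.575–576] -/
theorem thm19_holder_boxCut (F : OrthFlow ι) (κ : ℝ) {ℓ k : ℕ} (hℓ : 1 ≤ ℓ) (hk : 1 ≤ k) (hn : 1 ≤ (ℓ + 1) ^ k)
    (hd : 1 ≤ d) (Mb : Fin (d + 1) → ℕ) (hMb : ∀ i, 1 ≤ Mb i) {K : ℕ} (hK16 : 16 ≤ K) (h4 : 4 ∣ K)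
    (hKM : ∀ ν, K ∣ Mb ν) {a m2 : ℝ} (ha : 0 < a) (hm : 0 ≤ m2) (A : ↥(Box d ℓ k Mb) → ↥(Box d ℓ k Mb) → ℝ)
    (At : (Fin (d + 1) → ℤ) → ↥(Box d ℓ k Mb) → ↥(Box d ℓ k Mb) → ℝ) (hanti : ∀ j u v, At j v u = -At j u v)
    (hplat : ∀ j (u v : ↥(Box d ℓ k Mb)), (∀ ν, |posR ℓ k Mb u ν - (K : ℝ) * j ν| ≤ 3 / 4 * (K : ℝ)) →
      (∀ ν, |posR ℓ k Mb v ν - (K : ℝ) * j ν| ≤ 3 / 4 * (K : ℝ)) → At j u v = A u v)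
    {cG cD cH cK : ℝ} (hcG : 0 ≤ cG) (hcD : 0 ≤ cD) (hcH : 0 ≤ cH) (hcK : 0 ≤ cK)
    (hG : ∀ j ∈ labelsK Mb K, ∀ Φ : ↥(Box d ℓ k (cubeMs Mb K j)) × ι → ℝ,
      supN (greenA d F κ ℓ k a m2 (cubeMs Mb K j) (baseEmb hn _) (stairContour hn _)
          (subField ℓ k Mb (cubeMs Mb K j) (cubeLo Mb K j) (cube_ho Mb K j) (At j)) *ᵥ Φ) ≤ cG * supN Φ)
    (hDG : ∀ j ∈ labelsK Mb K, ∀ (ν : Fin (d + 1)) (Φ : ↥(Box d ℓ k (cubeMs Mb K j)) × ι → ℝ),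
      supN (derivA d F κ ℓ k (cubeMs Mb K j) (subField ℓ k Mb (cubeMs Mb K j) (cubeLo Mb K j) (cube_ho Mb K j) (At j)) ν
        *ᵥ (greenA d F κ ℓ k a m2 (cubeMs Mb K j) (baseEmb hn _) (stairContour hn _)
            (subField ℓ k Mb (cubeMs Mb K j) (cubeLo Mb K j) (cube_ho Mb K j) (At j)) *ᵥ Φ)) ≤ cD * supN Φ)
    (hKG : ∀ j ∈ labelsK Mb K, ∀ Φ : ↥(Box d ℓ k (cubeMs Mb K j)) × ι → ℝ,
      supN (kOp F κ ((ℓ + 1) ^ k) (B1.aSeq a ((ℓ : ℝ) + 1) k) m2 (cubeMs Mb K j) (baseEmb hn _) (stairContour hn _)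
            (subField ℓ k Mb (cubeMs Mb K j) (cubeLo Mb K j) (cube_ho Mb K j) (At j))
            (hBox ((ℓ + 1) ^ k) K (cubeMs Mb K j) (jloc j))
          *ᵥ (greenA d F κ ℓ k a m2 (cubeMs Mb K j) (baseEmb hn _) (stairContour hn _)
              (subField ℓ k Mb (cubeMs Mb K j) (cubeLo Mb K j) (cube_ho Mb K j) (At j))
            *ᵥ (mulH (ι := ι) (hBox ((ℓ + 1) ^ k) K (cubeMs Mb K j) (jloc j)) *ᵥ Φ))) ≤ cK * supN Φ)
    (h3 : (3 : ℝ) ^ (d + 1) * (Real.sqrt (Fintype.card ι) * cK) ≤ Real.exp (-1))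
    -- the pair, the bonds, the chain, the Hölder weight
    (μ : Fin (d + 1)) (x x' : ↥(Box d ℓ k Mb)) (hxμ : x.1 + e1 μ ∈ Box d ℓ k Mb) (hx'μ : x'.1 + e1 μ ∈ Box d ℓ k Mb)
    (hne : x'.1 ≠ x.1) (hclose : 32 * supNorm (x'.1 - x.1) ≤ (((ℓ + 1) ^ k : ℕ) : ℝ) * K)
    (l : List ↥(Box d ℓ k Mb)) (hl : IsNNChain x l) (hlend : pathEnd x l = x')
    (hlen : (l.length : ℝ) ≤ ((d : ℝ) + 1) * supNorm (x'.1 - x.1))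
    (hlnear : ∀ z ∈ l, supNorm (z.1 - x.1) ≤ supNorm (x'.1 - x.1)) {α : ℝ} (hα0 : 0 ≤ α) (hα1 : α ≤ 1)
    (hHG : ∀ j ∈ labelsK Mb K, ∀ (b b' : ↥(Box d ℓ k (cubeMs Mb K j)))
      (hbμ : b.1 + e1 μ ∈ Box d ℓ k (cubeMs Mb K j)) (hb'μ : b'.1 + e1 μ ∈ Box d ℓ k (cubeMs Mb K j)),
      b'.1 ≠ b.1 → ∀ (lb : List ↥(Box d ℓ k (cubeMs Mb K j))), IsNNChain b lb → pathEnd b lb = b' →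
      (lb.length : ℝ) ≤ ((d : ℝ) + 1) * supNorm (b'.1 - b.1) →
      ∀ Φ : ↥(Box d ℓ k (cubeMs Mb K j)) × ι → ℝ,
      ((((ℓ + 1) ^ k : ℕ) : ℝ) / supNorm (b'.1 - b.1)) ^ α *
        siteNorm (transport (fieldLink F κ (subField ℓ k Mb (cubeMs Mb K j) (cubeLo Mb K j) (cube_ho Mb K j) (At j))) b lb
            *ᵥ fld (derivA d F κ ℓ k (cubeMs Mb K j)
                    (subField ℓ k Mb (cubeMs Mb K j) (cubeLo Mb K j) (cube_ho Mb K j) (At j)) μ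
                  *ᵥ (greenA d F κ ℓ k a m2 (cubeMs Mb K j) (baseEmb hn _) (stairContour hn _)
                      (subField ℓ k Mb (cubeMs Mb K j) (cubeLo Mb K j) (cube_ho Mb K j) (At j)) *ᵥ Φ)) b'
          - fld (derivA d F κ ℓ k (cubeMs Mb K j)
                    (subField ℓ k Mb (cubeMs Mb K j) (cubeLo Mb K j) (cube_ho Mb K j) (At j)) μ
                  *ᵥ (greenA d F κ ℓ k a m2 (cubeMs Mb K j) (baseEmb hn _) (stairContour hn _)
                      (subField ℓ k Mb (cubeMs Mb K j) (cubeLo Mb K j) (cube_ho Mb K j) (At j)) *ᵥ Φ)) b)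
        ≤ cH * supN Φ)
    -- the source
    (P : ↥(Box d ℓ k Mb) → Prop) [DecidablePred P] {D : ℝ}
    (hD : ∀ x'', P x'' → ∃ ν, D ≤ |posR ℓ k Mb x ν - posR ℓ k Mb x'' ν|)
    (f : ↥(Box d ℓ k Mb) × ι → ℝ) (hfP : ∀ p, ¬ P p.1 → f p = 0) {φ : ℝ} (hφ : 0 ≤ φ) (hf : ∀ p, |f p| ≤ φ)
    (i0 : ι) :
    ((((ℓ + 1) ^ k : ℕ) : ℝ) / supNorm (x'.1 - x.1)) ^ α *
      |(transport (fieldLink F κ A) x l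
          *ᵥ fld (derivA d F κ ℓ k Mb A μ
                *ᵥ (greenA d F κ ℓ k a m2 Mb (baseEmb hn Mb) (stairContour hn Mb) A *ᵥ f)) x'
        - fld (derivA d F κ ℓ k Mb A μ
                *ᵥ (greenA d F κ ℓ k a m2 Mb (baseEmb hn Mb) (stairContour hn Mb) A *ᵥ f)) x) i0|
      ≤ 2 ^ (d + 4) * Real.exp (5 / 2)
          * (Real.sqrt (Fintype.card ι) * (cH + ((d : ℝ) + 1) * D1 hprof * cD
              + ((d : ℝ) + 3) * (((d : ℝ) + 1) * (D1 hprof + D2 hprof)) * cD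
              + ((d : ℝ) + 1) * (D1 hprof ^ 2 + D2 hprof) * cG))
          * Real.exp (-(D / K)) * φ := by
  classical
  -- scalars
  have hK8 : 8 ≤ K := le_trans (by norm_num) hK16
  have hK1 : 1 ≤ K := le_trans (by norm_num) hK16
  have hKr : (0 : ℝ) < K := by exact_mod_cast hK1
  have hK16r : (16 : ℝ) ≤ K := by exact_mod_cast hK16
  have hn2 : 2 ≤ (ℓ + 1) ^ k := by
    calc 2 ≤ ℓ + 1 := by omega
      _ = (ℓ + 1) ^ 1 := (pow_one _).symm
      _ ≤ (ℓ + 1) ^ k := Nat.pow_le_pow_right (Nat.succ_pos ℓ) hk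
  have hn2M : ∀ i, 2 ≤ (ℓ + 1) ^ k * Mb i := fun i => by nlinarith [hMb i]
  set nr : ℝ := (((ℓ + 1) ^ k : ℕ) : ℝ) with hnr_def
  have hnr : (0 : ℝ) < nr := by rw [hnr_def]; exact_mod_cast hn
  have hnr2 : (2 : ℝ) ≤ nr := by rw [hnr_def]; exact_mod_cast hn2
  have hnK : 3 ≤ (ℓ + 1) ^ k * K := by nlinarith
  have hnK32 : (32 : ℝ) ≤ nr * K := by nlinarith
  set r : ℝ := supNorm (x'.1 - x.1) with hr_def
  have hr1 : 1 ≤ r := one_le_supNorm_of_ne hne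
  have hr0 : 0 ≤ r := by linarith
  have hrK : r ≤ nr * K := by linarith
  set w : ℝ := (nr / r) ^ α with hw_def
  have hw0 : 0 ≤ w := Real.rpow_nonneg (div_nonneg hnr.le hr0) α
  have hD1 := D1_nonneg contDiff_hprof hasCompactSupport_hprof
  have hD2 := D2_nonneg contDiff_hprof hasCompactSupport_hprof
  -- the bond end points and the probe data
  set y : ↥(Box d ℓ k Mb) := ⟨x.1 + e1 μ, hxμ⟩ with hy
  set y' : ↥(Box d ℓ k Mb) := ⟨x'.1 + e1 μ, hx'μ⟩ with hy'
  set W : ↥(Box d ℓ k Mb) → ↥(Box d ℓ k Mb) → Matrix ι ι ℝ := fieldLink F κ A with hW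
  set U : Matrix ι ι ℝ := transport W x l with hU
  set Gr : (Fin (d + 1) → ℤ) → Matrix (↥(Box d ℓ k Mb) × ι) (↥(Box d ℓ k Mb) × ι) ℝ :=
    fun j => cubeGreen ℓ k Mb (cubeMs Mb K j) (cubeLo Mb K j) F κ (cube_ho Mb K j) hn a m2 (At j) with hGr
  set hh : (Fin (d + 1) → ℤ) → ↥(Box d ℓ k Mb) → ℝ := fun j z => hCube (K : ℝ) j (posR ℓ k Mb z) with hhh
  -- integer distances to `x`: every relevant point is within `r + 1`
  have dx : ∀ ν, |((x.1 ν : ℤ) : ℝ) - x.1 ν| ≤ r + 1 := fun ν => by rw [sub_self, abs_zero]; linarith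
  have dy : ∀ ν, |((y.1 ν : ℤ) : ℝ) - x.1 ν| ≤ r + 1 := fun ν => by
    rw [hy]; simp only [Pi.add_apply, Int.cast_add, add_sub_cancel_left]
    exact (abs_e1_cast_le μ ν).trans (by linarith)
  have dx' : ∀ ν, |((x'.1 ν : ℤ) : ℝ) - x.1 ν| ≤ r + 1 := fun ν => by
    have h := abs_le_supNorm (x'.1 - x.1) ν
    rw [Pi.sub_apply, Int.cast_abs, Int.cast_sub] at h
    exact h.trans (by linarith)
  have dy' : ∀ ν, |((y'.1 ν : ℤ) : ℝ) - x.1 ν| ≤ r + 1 := fun ν => by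
    rw [hy']; simp only [Pi.add_apply, Int.cast_add]
    have h := abs_le_supNorm (x'.1 - x.1) ν
    rw [Pi.sub_apply, Int.cast_abs, Int.cast_sub] at h
    calc |((x'.1 ν : ℤ) : ℝ) + ((e1 μ ν : ℤ) : ℝ) - x.1 ν| = |(((x'.1 ν : ℤ) : ℝ) - x.1 ν) + ((e1 μ ν : ℤ) : ℝ)| := by
          ring_nf
      _ ≤ |((x'.1 ν : ℤ) : ℝ) - x.1 ν| + |((e1 μ ν : ℤ) : ℝ)| := abs_add_le _ _
      _ ≤ r + 1 := add_le_add h (abs_e1_cast_le μ ν)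
  have dl : ∀ z ∈ l, ∀ ν, |((z.1 ν : ℤ) : ℝ) - x.1 ν| ≤ r + 1 := fun z hz ν => by
    have h := abs_le_supNorm (z.1 - x.1) ν
    rw [Pi.sub_apply, Int.cast_abs, Int.cast_sub] at h
    exact h.trans ((hlnear z hz).trans (by linarith))
  -- unit-lattice distances: `(2r+2)/n ≤ K/8`
  have hclose' : (2 * r + 2) / nr ≤ 1 / 8 * (K : ℝ) := by
    rw [div_le_iff₀ hnr]; nlinarith
  have hpair : ∀ (p q : ↥(Box d ℓ k Mb)), (∀ ν, |((p.1 ν : ℤ) : ℝ) - x.1 ν| ≤ r + 1) →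
      (∀ ν, |((q.1 ν : ℤ) : ℝ) - x.1 ν| ≤ r + 1) → ∀ ν, |posR ℓ k Mb q ν - posR ℓ k Mb p ν| ≤ 1 / 8 * (K : ℝ) := by
    intro p q hp hq ν
    have h2 : ∀ ν, |((q.1 ν : ℤ) : ℝ) - p.1 ν| ≤ 2 * r + 2 := fun ν => by
      calc |((q.1 ν : ℤ) : ℝ) - p.1 ν| = |(((q.1 ν : ℤ) : ℝ) - x.1 ν) - (((p.1 ν : ℤ) : ℝ) - x.1 ν)| := by ring_nf
        _ ≤ |((q.1 ν : ℤ) : ℝ) - x.1 ν| + |((p.1 ν : ℤ) : ℝ) - x.1 ν| := abs_sub _ _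
        _ ≤ 2 * r + 2 := by linarith [hp ν, hq ν]
    exact (abs_posR_sub_le h2 ν).trans hclose'
  have hxy : ∀ ν, |posR ℓ k Mb x ν - posR ℓ k Mb y ν| ≤ 1 / 8 * (K : ℝ) := hpair y x dy dx
  have hxx' : ∀ ν, |posR ℓ k Mb x ν - posR ℓ k Mb x' ν| ≤ 1 / 8 * (K : ℝ) := hpair x' x dx' dx
  have hx'y' : ∀ ν, |posR ℓ k Mb x' ν - posR ℓ k Mb y' ν| ≤ 1 / 8 * (K : ℝ) := hpair y' x' dy' dx'
  -- the per-cube Hölder input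
  set γH : ℝ := Real.sqrt (Fintype.card ι) * (cH + ((d : ℝ) + 1) * D1 hprof * cD
      + ((d : ℝ) + 3) * (((d : ℝ) + 1) * (D1 hprof + D2 hprof)) * cD
      + ((d : ℝ) + 1) * (D1 hprof ^ 2 + D2 hprof) * cG) with hγH_def
  have hγH0 : 0 ≤ γH := by rw [hγH_def]; positivity
  have hγH : ∀ j : ↥(labelsK Mb K),
      ‖(nr * w) • (unitOp x y' (U * W x' y') - unitOp x x' U - (unitOp x y (W x y) - unitOp x x 1))
        * (mulH (ι := ι) (hh j.1) * Gr j.1 * mulH (ι := ι) (hh j.1))‖ ≤ γH := by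
    intro j
    by_cases hzero : hh j.1 x = 0 ∧ hh j.1 y = 0 ∧ hh j.1 x' = 0 ∧ hh j.1 y' = 0
    · -- the probe does not see `h_j`: the letter vanishes
      obtain ⟨h1, h2, h3', h4'⟩ := hzero
      rw [← Matrix.mul_assoc, ← Matrix.mul_assoc, holderOp_mul_mulH, h1, h2, h3', h4']
      simp only [zero_smul, sub_self, smul_zero, Matrix.zero_mul, norm_zero]
      exact hγH0
    · -- some of the four points is seen by `h_j`: everything is in the plateau of `□_j`, hence in the sub-box
      have hseen : ∃ p : ↥(Box d ℓ k Mb), hh j.1 p ≠ 0 ∧ ∀ ν, |((p.1 ν : ℤ) : ℝ) - x.1 ν| ≤ r + 1 := by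
        by_cases a1 : hh j.1 x = 0
        · by_cases a2 : hh j.1 y = 0
          · by_cases a3 : hh j.1 x' = 0
            · have a4 : hh j.1 y' ≠ 0 := fun a4 => hzero ⟨a1, a2, a3, a4⟩
              exact ⟨y', a4, dy'⟩
            · exact ⟨x', a3, dx'⟩
          · exact ⟨y, a2, dy⟩
        · exact ⟨x, a1, dx⟩
      obtain ⟨p, hp, dp⟩ := hseen
      have hpl : ∀ q : ↥(Box d ℓ k Mb), (∀ ν, |((q.1 ν : ℤ) : ℝ) - x.1 ν| ≤ r + 1) →
          ∀ ν, |posR ℓ k Mb q ν - (K : ℝ) * j.1 ν| ≤ 3 / 4 * (K : ℝ) := by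
        intro q hq ν
        have h1 := hCube_ne_zero_imp hKr hp ν
        have h2 := hpair p q dp hq ν
        calc |posR ℓ k Mb q ν - (K : ℝ) * j.1 ν|
            ≤ |posR ℓ k Mb q ν - posR ℓ k Mb p ν| + |posR ℓ k Mb p ν - (K : ℝ) * j.1 ν| := abs_sub_le _ _ _
          _ ≤ 1 / 8 * (K : ℝ) + 5 / 8 * (K : ℝ) := add_le_add h2 h1.le
          _ = 3 / 4 * (K : ℝ) := by ring
      -- the sub-box of `j` and the preimages of the four points and of the chain
      have ho := cube_ho Mb K j.1
      set Ms := cubeMs Mb K j.1 with hMs_def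
      set o := cubeLo Mb K j.1 with ho_def
      have he : Function.Injective (subEmb ℓ k Mb Ms o ho) := subEmb_injective ℓ k Mb Ms o ho
      have hea : ∀ c : ↥(Box d ℓ k Ms),
          (subEmb ℓ k Mb Ms o ho c).1 = c.1 + fun i => (((ℓ + 1) ^ k : ℕ) : ℤ) * (o i : ℤ) := fun c => rfl
      have hinS : ∀ q : ↥(Box d ℓ k Mb), (∀ ν, |((q.1 ν : ℤ) : ℝ) - x.1 ν| ≤ r + 1) → inSub ℓ k Mb Ms o q :=
        fun q hq => cubeS_of_plateau hK1 j.1 q (hpl q hq)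
      obtain ⟨a0, ha0⟩ := (inSub_iff ℓ k Mb Ms o ho x).1 (hinS x dx)
      obtain ⟨b0, hb0⟩ := (inSub_iff ℓ k Mb Ms o ho y).1 (hinS y dy)
      obtain ⟨a1, ha1⟩ := (inSub_iff ℓ k Mb Ms o ho x').1 (hinS x' dx')
      obtain ⟨b1, hb1⟩ := (inSub_iff ℓ k Mb Ms o ho y').1 (hinS y' dy')
      obtain ⟨lB, hlB, hlBchain, hlBend, hlBlen⟩ :=
        exists_chain_preimage_sub ℓ k Mb Ms o ho x l a0 ha0 hl fun z hz => hinS z (dl z hz)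
      -- coordinates of the preimages
      have hb0eq : b0.1 = a0.1 + e1 μ := by
        have h1 : (subEmb ℓ k Mb Ms o ho b0).1 = (subEmb ℓ k Mb Ms o ho a0).1 + e1 μ := by rw [ha0, hb0]
        rw [hea, hea, add_right_comm] at h1
        exact add_right_cancel h1
      have hb1eq : b1.1 = a1.1 + e1 μ := by
        have h1 : (subEmb ℓ k Mb Ms o ho b1).1 = (subEmb ℓ k Mb Ms o ho a1).1 + e1 μ := by rw [ha1, hb1]
        rw [hea, hea, add_right_comm] at h1
        exact add_right_cancel h1
      have ha0μ : a0.1 + e1 μ ∈ Box d ℓ k Ms := by rw [← hb0eq]; exact b0.2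
      have ha1μ : a1.1 + e1 μ ∈ Box d ℓ k Ms := by rw [← hb1eq]; exact b1.2
      have hb0' : b0 = ⟨a0.1 + e1 μ, ha0μ⟩ := Subtype.ext hb0eq
      have hb1' : b1 = ⟨a1.1 + e1 μ, ha1μ⟩ := Subtype.ext hb1eq
      have hend : pathEnd a0 lB = a1 := by
        apply he
        rw [hlBend, hlend, ha1]
      have hdiff : a1.1 - a0.1 = x'.1 - x.1 := by
        have h1 : (subEmb ℓ k Mb Ms o ho a1).1 - (subEmb ℓ k Mb Ms o ho a0).1 = x'.1 - x.1 := by rw [ha0, ha1]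
        rw [hea, hea] at h1
        rw [← h1]; abel
      have hne' : a1.1 ≠ a0.1 := by
        intro h
        apply hne
        have : x'.1 - x.1 = 0 := by rw [← hdiff, h, sub_self]
        exact sub_eq_zero.mp this
      have hlen' : (lB.length : ℝ) ≤ ((d : ℝ) + 1) * supNorm (a1.1 - a0.1) := by
        rw [hlBlen, hdiff]; exact hlen
      have hrK' : supNorm (a1.1 - a0.1) ≤ (((ℓ + 1) ^ k : ℕ) : ℝ) * K := by rw [hdiff]; exact hrK
      -- the region's links and transport are the sub-box field's (plateau agreement)
      set B : ↥(Box d ℓ k Ms) → ↥(Box d ℓ k Ms) → ℝ := subField ℓ k Mb Ms o ho (At j.1) with hB_def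
      have hBanti : ∀ u v, B v u = -B u v := fun u v => hanti j.1 _ _
      have hWpt : ∀ (p q : ↥(Box d ℓ k Mb)) (c c' : ↥(Box d ℓ k Ms)), subEmb ℓ k Mb Ms o ho c = p →
          subEmb ℓ k Mb Ms o ho c' = q → (∀ ν, |((p.1 ν : ℤ) : ℝ) - x.1 ν| ≤ r + 1) →
          (∀ ν, |((q.1 ν : ℤ) : ℝ) - x.1 ν| ≤ r + 1) → W p q = fieldLink F κ B c c' := by
        intro p q c c' hc hc' hp hq
        rw [hW]
        show F.U (κ * A p q) = F.U (κ * At j.1 (subEmb ℓ k Mb Ms o ho c) (subEmb ℓ k Mb Ms o ho c'))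
        rw [hc, hc', hplat j.1 p q (hpl p hp) (hpl q hq)]
      have hWxy : W x y = fieldLink F κ B a0 ⟨a0.1 + e1 μ, ha0μ⟩ := by
        rw [← hb0']; exact hWpt x y a0 b0 ha0 hb0 dx dy
      have hWx'y' : W x' y' = fieldLink F κ B a1 ⟨a1.1 + e1 μ, ha1μ⟩ := by
        rw [← hb1']; exact hWpt x' y' a1 b1 ha1 hb1 dx' dy'
      have hUeq : U = transport (fieldLink F κ B) a0 lB := by
        rw [hU, ← ha0, ← hlB, transport_map]
        -- the pulled-back links of `A` along the chain are the links of `B`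
        rw [show (fun u v : ↥(Box d ℓ k Ms) => W (subEmb ℓ k Mb Ms o ho u) (subEmb ℓ k Mb Ms o ho v))
            = fieldLink F κ (fun u v : ↥(Box d ℓ k Ms) => A (subEmb ℓ k Mb Ms o ho u) (subEmb ℓ k Mb Ms o ho v))
            from rfl, transport_fieldLink, transport_fieldLink]
        congr 2
        refine lsum_congr_of_forall (P := fun c : ↥(Box d ℓ k Ms) =>
          ∀ ν, |(((subEmb ℓ k Mb Ms o ho c).1 ν : ℤ) : ℝ) - x.1 ν| ≤ r + 1) ?_ a0 lB ?_ ?_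
        · intro u v hu hv
          exact (hplat j.1 _ _ (hpl _ hu) (hpl _ hv)).symm
        · rw [ha0]; exact dx
        · intro c hc
          have : subEmb ℓ k Mb Ms o ho c ∈ l := by rw [← hlB]; exact List.mem_map.2 ⟨c, hc, rfl⟩
          exact dl _ this
      -- the letter and the probe are paddings
      have hL := cube_letter_a ℓ k Mb Ms o F κ ho hn a m2 (At j.1) (hh j.1)
        (fun z hz => cubeS_of_hCube_ne_zero hK1 j.1 z hz)
      have hhsub : (fun c : ↥(Box d ℓ k Ms) => hh j.1 (subEmb ℓ k Mb Ms o ho c)) = hBox ((ℓ + 1) ^ k) K Ms (jloc j.1) :=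
        funext fun c => hCube_subEmb hK1 hKM j.2 c
      have hPpad : (nr * w) • (unitOp x y' (U * W x' y') - unitOp x x' U - (unitOp x y (W x y) - unitOp x x 1))
          = pad (subEmb ℓ k Mb Ms o ho) ((nr * w) •
              (unitOp a0 ⟨a1.1 + e1 μ, ha1μ⟩ (transport (fieldLink F κ B) a0 lB * fieldLink F κ B a1 ⟨a1.1 + e1 μ, ha1μ⟩)
                - unitOp a0 a1 (transport (fieldLink F κ B) a0 lB)
                - (unitOp a0 ⟨a0.1 + e1 μ, ha0μ⟩ (fieldLink F κ B a0 ⟨a0.1 + e1 μ, ha0μ⟩) - unitOp a0 a0 1))) := by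
        rw [pad_smul, pad_sub, pad_sub, pad_sub, ← unitOp_eq_pad he, ← unitOp_eq_pad he, ← unitOp_eq_pad he,
          ← unitOp_eq_pad he, ← hb0', ← hb1', ha0, ha1, hb0, hb1, hWxy, hWx'y', hUeq, hb0', hb1']
      rw [hGr]
      dsimp only
      rw [hL, hPpad, pad_mul he, norm_pad he, hhsub, hw_def, hr_def, ← hdiff]
      exact holder_letter_box F κ hn hK1 hnK (fun ν => dvd_cubeMs hK1 hKM hMb j.2 ν) B hBanti _ (jloc j.1) hcG hcD hcH
        (hG j.1 j.2) (hDG j.1 j.2) μ a0 a1 ha0μ ha1μ hne' hrK' lB hlBchain hend hlen' hα0 hα1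
        (hHG j.1 j.2 a0 a1 ha0μ ha1μ hne' lB hlBchain hend hlen')
  -- the walk route for the Hölder probe
  have main := ineq19_holder_apply (X := ↥(Box d ℓ k Mb)) (Y := ↥(boxDom Mb)) (κ := ι) hKr (posR ℓ k Mb)
    (boxWt ((ℓ + 1) ^ k) (fun i => (ℓ + 1) ^ k * Mb i)) m2
    (B1.aSeq a ((ℓ : ℝ) + 1) k * (((((ℓ + 1) ^ k : ℕ)) : ℝ) ^ (d + 1))⁻¹)
    (blkWt ((ℓ + 1) ^ k) Mb (fun i => (ℓ + 1) ^ k * Mb i)) W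
    (contourTrans (fieldLink F κ A) (baseEmb hn Mb) (stairContour hn Mb))
    (fun _ _ h => boxWt_local hK8 h) (fun _ _ _ h h' => blkWt_local hK8 h h')
    (labelsK Mb K) (fun j z h => mem_labelsK_of_hCube_ne_zero hK1 hKM j z h)
    (fun j => cubeS ℓ k Mb K j) (fun j z hz => cubeS_of_near hK1 j z hz)
    (fun j => cubeW ℓ k Mb (cubeMs Mb K j) (cubeLo Mb K j) F κ (At j))
    (fun j => cubeT ℓ k Mb (cubeMs Mb K j) (cubeLo Mb K j) F κ hn (At j))
    (fun j u v hu hv => by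
      show (if inSub ℓ k Mb (cubeMs Mb K j) (cubeLo Mb K j) u ∧ inSub ℓ k Mb (cubeMs Mb K j) (cubeLo Mb K j) v
        then fieldLink F κ (At j) u v else 0) = fieldLink F κ A u v
      rw [if_pos ⟨cubeS_of_plateau hK1 j u hu, cubeS_of_plateau hK1 j v hv⟩]
      show F.U (κ * At j u v) = F.U (κ * A u v)
      rw [hplat j u v hu hv])
    (fun j y'' u hq hu => by
      show (if inSub ℓ k Mb (cubeMs Mb K j) (cubeLo Mb K j) u then
        contourTrans (fieldLink F κ (At j)) (baseEmb hn Mb) (stairContour hn Mb) y'' u else 0)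
        = contourTrans (fieldLink F κ A) (baseEmb hn Mb) (stairContour hn Mb) y'' u
      rw [if_pos (cubeS_of_plateau hK1 j u hu)]
      exact contourTrans_plateau F κ h4 hn (hplat j) hu hq)
    Gr
    (fun j _ => cubeOp_mul_cubeGreen ℓ k Mb _ _ F κ (cube_ho Mb K j) hℓ hk hn ha hm hd hn2M (At j))
    (greenA d F κ ℓ k a m2 Mb (baseEmb hn Mb) (stairContour hn Mb) A)
    (Matrix.nonsing_inv_mul _ (opA_stair_isUnit_det F κ hℓ hk hn ha hm Mb A))
    x y x' y' hxy hxx' hx'y' (nr * w) U (β := Real.sqrt (Fintype.card ι) * cK) hγH0 hγH (by positivity)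
    (fun j => by
      rw [hGr]
      dsimp only
      rw [cube_letter_b ℓ k Mb _ _ F κ (cube_ho Mb K j.1) hn a m2 (At j.1) _
        (fun z hz => cubeS_of_hCube_ne_zero hK1 j.1 z hz), norm_pad (subEmb_injective ℓ k Mb _ _ _)]
      refine linfty_opNorm_le_of_supN _ hcK fun Φ => ?_
      have hh' : (fun b : ↥(Box d ℓ k (cubeMs Mb K j.1)) =>
          hCube (K : ℝ) j.1 (posR ℓ k Mb (subEmb ℓ k Mb (cubeMs Mb K j.1) (cubeLo Mb K j.1) (cube_ho Mb K j.1) b)))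
          = hBox ((ℓ + 1) ^ k) K (cubeMs Mb K j.1) (jloc j.1) :=
        funext fun b => hCube_subEmb hK1 hKM j.2 b
      rw [hh', ← Matrix.mulVec_mulVec, ← Matrix.mulVec_mulVec]
      exact hKG j.1 j.2 Φ)
    h3 P hD f hfP hφ hf i0
  -- identify the probe's value with the Hölder quotient of `D^η_{A,μ}G f`
  set Ψ := greenA d F κ ℓ k a m2 Mb (baseEmb hn Mb) (stairContour hn Mb) A *ᵥ f with hΨ
  have hderiv : ∀ (u : ↥(Box d ℓ k Mb)) (hu : u.1 + e1 μ ∈ Box d ℓ k Mb),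
      W u ⟨u.1 + e1 μ, hu⟩ *ᵥ fld Ψ ⟨u.1 + e1 μ, hu⟩ - fld Ψ u = nr⁻¹ • fld (derivA d F κ ℓ k Mb A μ *ᵥ Ψ) u := by
    intro u hu
    rw [show derivA d F κ ℓ k Mb A μ = covDeriv ((ℓ + 1) ^ k) (Box d ℓ k Mb) (fieldLink F κ A) μ from rfl,
      fld_covDeriv_mulVec_of_mem ((ℓ + 1) ^ k) (fieldLink F κ A) Ψ hu, smul_smul, hnr_def,
      inv_mul_cancel₀ hnr.ne', one_smul]
  have hid : (nr * w) • (U *ᵥ (W x' y' *ᵥ fld Ψ y' - fld Ψ x') - (W x y *ᵥ fld Ψ y - fld Ψ x))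
      = w • (U *ᵥ fld (derivA d F κ ℓ k Mb A μ *ᵥ Ψ) x' - fld (derivA d F κ ℓ k Mb A μ *ᵥ Ψ) x) := by
    rw [hy, hy', hderiv x' hx'μ, hderiv x hxμ, Matrix.mulVec_smul, ← smul_sub, smul_smul,
      show nr * w * nr⁻¹ = w by field_simp]
  rw [hid] at main
  rw [Pi.smul_apply, smul_eq_mul, abs_mul, abs_of_nonneg hw0] at main
  refine main.trans (le_of_eq ?_)
  ring

/-! ## §3. The print's cube configurations `Ã_j` -/

/-- **THEOREM (1.9), HÖLDER MEMBER, ON A BOX WITH THE CUT CUBES, FOR `A = compField Ac` AND p35's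
`Ã_j = A₀ + θ_j(A − A₀)`** with a per-label base value `A₀ j` (antisymmetric by `cubeField_antisymm`, agreeing with `A` on
the plateaus by `cubeField_eq_compField`): the inputs are about the cube configuration of the translated field on the
sub-box (`subField_cubeField`) — the output forms of `B4Eq220CubeField.lemma22_sup_cubeField` (.1, .2), `eq220_cubeField`
and `B4Lemma22HolderCubeField.lemma22_holder_cubeField` on a box of sides `cubeMs j ≤ 2K`.
[cite: Balaban1983RegularityDecay, Theorem (1.9) p.573; §2 pp.575–579] -/
theorem thm19_holder_boxCut_cubeField (F : OrthFlow ι) {ℓ k : ℕ} (hℓ : 1 ≤ ℓ) (hk : 1 ≤ k) (hn : 1 ≤ (ℓ + 1) ^ k)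
    (hd : 1 ≤ d) (Mb : Fin (d + 1) → ℕ) (hMb : ∀ i, 1 ≤ Mb i) {K : ℕ} (hK16 : 16 ≤ K) (h4 : 4 ∣ K)
    (hKM : ∀ ν, K ∣ Mb ν) {a m2 : ℝ} (ha : 0 < a) (hm : 0 ≤ m2) (e : ℝ)
    (Ac : (Fin (d + 1) → ℤ) → Fin (d + 1) → ℝ) (A₀ : (Fin (d + 1) → ℤ) → Fin (d + 1) → ℝ)
    {cG cD cH cK : ℝ} (hcG : 0 ≤ cG) (hcD : 0 ≤ cD) (hcH : 0 ≤ cH) (hcK : 0 ≤ cK)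
    (hG : ∀ j ∈ labelsK Mb K, ∀ Φ : ↥(Box d ℓ k (cubeMs Mb K j)) × ι → ℝ,
      supN (greenA d F (e / ((ℓ + 1) ^ k : ℕ)) ℓ k a m2 (cubeMs Mb K j) (baseEmb hn _) (stairContour hn _)
          (cubeField (Box d ℓ k (cubeMs Mb K j)) ((ℓ + 1) ^ k) K (jloc j) (A₀ j)
            (fun y => Ac (y + fun i => (((ℓ + 1) ^ k : ℕ) : ℤ) * (cubeLo Mb K j i : ℤ)))) *ᵥ Φ) ≤ cG * supN Φ)
    (hDG : ∀ j ∈ labelsK Mb K, ∀ (ν : Fin (d + 1)) (Φ : ↥(Box d ℓ k (cubeMs Mb K j)) × ι → ℝ),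
      supN (derivA d F (e / ((ℓ + 1) ^ k : ℕ)) ℓ k (cubeMs Mb K j)
          (cubeField (Box d ℓ k (cubeMs Mb K j)) ((ℓ + 1) ^ k) K (jloc j) (A₀ j)
            (fun y => Ac (y + fun i => (((ℓ + 1) ^ k : ℕ) : ℤ) * (cubeLo Mb K j i : ℤ)))) ν
        *ᵥ (greenA d F (e / ((ℓ + 1) ^ k : ℕ)) ℓ k a m2 (cubeMs Mb K j) (baseEmb hn _) (stairContour hn _)
          (cubeField (Box d ℓ k (cubeMs Mb K j)) ((ℓ + 1) ^ k) K (jloc j) (A₀ j)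
            (fun y => Ac (y + fun i => (((ℓ + 1) ^ k : ℕ) : ℤ) * (cubeLo Mb K j i : ℤ)))) *ᵥ Φ)) ≤ cD * supN Φ)
    (hKG : ∀ j ∈ labelsK Mb K, ∀ Φ : ↥(Box d ℓ k (cubeMs Mb K j)) × ι → ℝ,
      supN (kOp F (e / ((ℓ + 1) ^ k : ℕ)) ((ℓ + 1) ^ k) (B1.aSeq a ((ℓ : ℝ) + 1) k) m2 (cubeMs Mb K j)
            (baseEmb hn _) (stairContour hn _)
            (cubeField (Box d ℓ k (cubeMs Mb K j)) ((ℓ + 1) ^ k) K (jloc j) (A₀ j)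
              (fun y => Ac (y + fun i => (((ℓ + 1) ^ k : ℕ) : ℤ) * (cubeLo Mb K j i : ℤ))))
            (hBox ((ℓ + 1) ^ k) K (cubeMs Mb K j) (jloc j))
          *ᵥ (greenA d F (e / ((ℓ + 1) ^ k : ℕ)) ℓ k a m2 (cubeMs Mb K j) (baseEmb hn _) (stairContour hn _)
              (cubeField (Box d ℓ k (cubeMs Mb K j)) ((ℓ + 1) ^ k) K (jloc j) (A₀ j)
                (fun y => Ac (y + fun i => (((ℓ + 1) ^ k : ℕ) : ℤ) * (cubeLo Mb K j i : ℤ))))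
            *ᵥ (mulH (ι := ι) (hBox ((ℓ + 1) ^ k) K (cubeMs Mb K j) (jloc j)) *ᵥ Φ))) ≤ cK * supN Φ)
    (h3 : (3 : ℝ) ^ (d + 1) * (Real.sqrt (Fintype.card ι) * cK) ≤ Real.exp (-1))
    (μ : Fin (d + 1)) (x x' : ↥(Box d ℓ k Mb)) (hxμ : x.1 + e1 μ ∈ Box d ℓ k Mb) (hx'μ : x'.1 + e1 μ ∈ Box d ℓ k Mb)
    (hne : x'.1 ≠ x.1) (hclose : 32 * supNorm (x'.1 - x.1) ≤ (((ℓ + 1) ^ k : ℕ) : ℝ) * K)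
    (l : List ↥(Box d ℓ k Mb)) (hl : IsNNChain x l) (hlend : pathEnd x l = x')
    (hlen : (l.length : ℝ) ≤ ((d : ℝ) + 1) * supNorm (x'.1 - x.1))
    (hlnear : ∀ z ∈ l, supNorm (z.1 - x.1) ≤ supNorm (x'.1 - x.1)) {α : ℝ} (hα0 : 0 ≤ α) (hα1 : α ≤ 1)
    (hHG : ∀ j ∈ labelsK Mb K, ∀ (b b' : ↥(Box d ℓ k (cubeMs Mb K j)))
      (hbμ : b.1 + e1 μ ∈ Box d ℓ k (cubeMs Mb K j)) (hb'μ : b'.1 + e1 μ ∈ Box d ℓ k (cubeMs Mb K j)),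
      b'.1 ≠ b.1 → ∀ (lb : List ↥(Box d ℓ k (cubeMs Mb K j))), IsNNChain b lb → pathEnd b lb = b' →
      (lb.length : ℝ) ≤ ((d : ℝ) + 1) * supNorm (b'.1 - b.1) →
      ∀ Φ : ↥(Box d ℓ k (cubeMs Mb K j)) × ι → ℝ,
      ((((ℓ + 1) ^ k : ℕ) : ℝ) / supNorm (b'.1 - b.1)) ^ α *
        siteNorm (transport (fieldLink F (e / ((ℓ + 1) ^ k : ℕ))
              (cubeField (Box d ℓ k (cubeMs Mb K j)) ((ℓ + 1) ^ k) K (jloc j) (A₀ j)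
                (fun y => Ac (y + fun i => (((ℓ + 1) ^ k : ℕ) : ℤ) * (cubeLo Mb K j i : ℤ))))) b lb
            *ᵥ fld (derivA d F (e / ((ℓ + 1) ^ k : ℕ)) ℓ k (cubeMs Mb K j)
                    (cubeField (Box d ℓ k (cubeMs Mb K j)) ((ℓ + 1) ^ k) K (jloc j) (A₀ j)
                      (fun y => Ac (y + fun i => (((ℓ + 1) ^ k : ℕ) : ℤ) * (cubeLo Mb K j i : ℤ)))) μ
                  *ᵥ (greenA d F (e / ((ℓ + 1) ^ k : ℕ)) ℓ k a m2 (cubeMs Mb K j) (baseEmb hn _) (stairContour hn _)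
                      (cubeField (Box d ℓ k (cubeMs Mb K j)) ((ℓ + 1) ^ k) K (jloc j) (A₀ j)
                        (fun y => Ac (y + fun i => (((ℓ + 1) ^ k : ℕ) : ℤ) * (cubeLo Mb K j i : ℤ)))) *ᵥ Φ)) b'
          - fld (derivA d F (e / ((ℓ + 1) ^ k : ℕ)) ℓ k (cubeMs Mb K j)
                    (cubeField (Box d ℓ k (cubeMs Mb K j)) ((ℓ + 1) ^ k) K (jloc j) (A₀ j)
                      (fun y => Ac (y + fun i => (((ℓ + 1) ^ k : ℕ) : ℤ) * (cubeLo Mb K j i : ℤ)))) μ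
                  *ᵥ (greenA d F (e / ((ℓ + 1) ^ k : ℕ)) ℓ k a m2 (cubeMs Mb K j) (baseEmb hn _) (stairContour hn _)
                      (cubeField (Box d ℓ k (cubeMs Mb K j)) ((ℓ + 1) ^ k) K (jloc j) (A₀ j)
                        (fun y => Ac (y + fun i => (((ℓ + 1) ^ k : ℕ) : ℤ) * (cubeLo Mb K j i : ℤ)))) *ᵥ Φ)) b)
        ≤ cH * supN Φ)
    (P : ↥(Box d ℓ k Mb) → Prop) [DecidablePred P] {D : ℝ}
    (hD : ∀ x'', P x'' → ∃ ν, D ≤ |posR ℓ k Mb x ν - posR ℓ k Mb x'' ν|)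
    (f : ↥(Box d ℓ k Mb) × ι → ℝ) (hfP : ∀ p, ¬ P p.1 → f p = 0) {φ : ℝ} (hφ : 0 ≤ φ) (hf : ∀ p, |f p| ≤ φ)
    (i0 : ι) :
    ((((ℓ + 1) ^ k : ℕ) : ℝ) / supNorm (x'.1 - x.1)) ^ α *
      |(transport (fieldLink F (e / ((ℓ + 1) ^ k : ℕ)) (fun u v : ↥(Box d ℓ k Mb) => compField Ac u.1 v.1)) x l
          *ᵥ fld (derivA d F (e / ((ℓ + 1) ^ k : ℕ)) ℓ k Mb (fun u v : ↥(Box d ℓ k Mb) => compField Ac u.1 v.1) μ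
                *ᵥ (greenA d F (e / ((ℓ + 1) ^ k : ℕ)) ℓ k a m2 Mb (baseEmb hn Mb) (stairContour hn Mb)
                    (fun u v : ↥(Box d ℓ k Mb) => compField Ac u.1 v.1) *ᵥ f)) x'
        - fld (derivA d F (e / ((ℓ + 1) ^ k : ℕ)) ℓ k Mb (fun u v : ↥(Box d ℓ k Mb) => compField Ac u.1 v.1) μ
                *ᵥ (greenA d F (e / ((ℓ + 1) ^ k : ℕ)) ℓ k a m2 Mb (baseEmb hn Mb) (stairContour hn Mb)
                    (fun u v : ↥(Box d ℓ k Mb) => compField Ac u.1 v.1) *ᵥ f)) x) i0|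
      ≤ 2 ^ (d + 4) * Real.exp (5 / 2)
          * (Real.sqrt (Fintype.card ι) * (cH + ((d : ℝ) + 1) * D1 hprof * cD
              + ((d : ℝ) + 3) * (((d : ℝ) + 1) * (D1 hprof + D2 hprof)) * cD
              + ((d : ℝ) + 1) * (D1 hprof ^ 2 + D2 hprof) * cG))
          * Real.exp (-(D / K)) * φ := by
  have hK1 : 1 ≤ K := le_trans (by norm_num) hK16
  have hsub : ∀ j ∈ labelsK Mb K, subField ℓ k Mb (cubeMs Mb K j) (cubeLo Mb K j) (cube_ho Mb K j)
      (cubeField (Box d ℓ k Mb) ((ℓ + 1) ^ k) K j (A₀ j) Ac)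
      = cubeField (Box d ℓ k (cubeMs Mb K j)) ((ℓ + 1) ^ k) K (jloc j) (A₀ j)
          (fun y => Ac (y + fun i => (((ℓ + 1) ^ k : ℕ) : ℤ) * (cubeLo Mb K j i : ℤ))) :=
    fun j hj => subField_cubeField hK1 hKM hj (A₀ j) Ac
  refine thm19_holder_boxCut F (e / ((ℓ + 1) ^ k : ℕ)) hℓ hk hn hd Mb hMb hK16 h4 hKM ha hm
    (fun u v : ↥(Box d ℓ k Mb) => compField Ac u.1 v.1)
    (fun j => cubeField (Box d ℓ k Mb) ((ℓ + 1) ^ k) K j (A₀ j) Ac)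
    (fun j u v => cubeField_antisymm _ _ _ _ _ u v)
    (fun j u v hu hv => cubeField_eq_compField hn hK1 j (A₀ j) Ac (fun ν => plateau_fine hu ν)
      (fun ν => plateau_fine hv ν))
    hcG hcD hcH hcK (fun j hj Φ => ?_) (fun j hj ν Φ => ?_) (fun j hj Φ => ?_) h3 μ x x' hxμ hx'μ hne hclose l hl
    hlend hlen hlnear hα0 hα1 (fun j hj b b' hbμ hb'μ hne' lb hlb hlbend hlblen Φ => ?_) P hD f hfP hφ hf i0
  · rw [hsub j hj]; exact hG j hj Φ
  · rw [hsub j hj]; exact hDG j hj ν Φ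
  · rw [hsub j hj]; exact hKG j hj Φ
  · rw [hsub j hj]; exact hHG j hj b b' hbμ hb'μ hne' lb hlb hlbend hlblen Φ

end Route

end

end Literature.MathematicalPhysics.QuantumFieldTheory.Balaban1983to89.B4Thm19BoxHolderCut
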